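import Mathlib
import Literature.Probability.MarkovChains.TotalVariation
import Summits.Ventures.LatticeQCDFlow.Scaling.ImportanceWeights

/-!
# LatticeQCDFlow / Scaling — blindness of model-sample diagnostics to uncovered modes (T2-L)

HONEST FRAMING: exact (Metropolis-corrected) sampling algorithms for lattice gauge theory;
figures of merit are autocorrelation/cost numbers at stated couplings and volumes; no
continuum-physics claim.

Venture `LatticeQCDFlow` (cell pub-lqcd), topic `Scaling`, item T2-L of HOME/THEORY-2.md §4
(v1.1; the theorem behind FITNESS.md §5's planted-control requirement), landed by FANOUT row 31
from `HOME/THEORY-2-Sketch.lean` (theory seat, decls verbatim).  `N` i.i.d. model samples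
(`iidLaw q`), their importance-weight vector `weightVec p q xs`, and the target restricted to a
set `C` of "covered" modes, `restrictLaw p C = p·1_C / p(C)`:

* `blindness` — ANY scale-invariant statistic `S` of the weight vector (ESS-hat, the IMH
  acceptance sequence, normalised histograms, …) takes the same value for the target `p` and for
  `p|_C` with the uncovered modes `Cᶜ` DELETED, except on the event that some sample falls in
  `Cᶜ`, of model probability `≤ 1 − q(C)^N ≤ N · q(Cᶜ)` (Bernoulli; in the tree as
  `Literature.MathematicalPhysics.QuantumFieldTheory.ChatterjeeJointLimit.one_sub_pow_le'`);
* `tvDist_restrictLaw` — while `‖p − p|_C‖_TV = p(Cᶜ)` exactly, and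
* `bias_restrictLaw` — the estimator that is exact for `p|_C` is biased for `p` by up to
  `2 · sup|O| · p(Cᶜ)`.
So mode collapse (`q(Cᶜ) ≪ p(Cᶜ)`) is invisible to model-sample diagnostics and must be
controlled with TARGET samples or planted controls (Nicoli et al. 2023, Thm 3).
-/

namespace Summit.Ventures.LatticeQCDFlow.Theory2

open Finset Literature.Probability.MarkovChains

variable {X : Type*} [Fintype X] [DecidableEq X]

/-! ## T2-L: blindness of model-sample diagnostics to uncovered modes -/

section Blindness

variable {N : ℕ}

/-- Law of `N` i.i.d. samples from the model `q`. [folklore] -/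
noncomputable def iidLaw (q : X → ℝ) : (Fin N → X) → ℝ := fun xs => ∏ i, q (xs i)

/-- Importance-weight vector `(p/q)(x_i)` of a sample `xs`. [folklore] -/
noncomputable def weightVec (p q : X → ℝ) (xs : Fin N → X) : Fin N → ℝ :=
  fun i => p (xs i) / q (xs i)

/-- The target restricted to a set `C` (the modes the model "covers") and renormalised. -/
noncomputable def restrictLaw (p : X → ℝ) (C : Finset X) : X → ℝ :=
  fun x => if x ∈ C then p x / ∑ y ∈ C, p y else 0

omit [Fintype X] in
/-- On a sample lying entirely in `C`, the weight vectors for `p` and for `p|_C` are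
PROPORTIONAL (factor `p(C)⁻¹`). [folklore] -/
theorem weightVec_restrictLaw_of_forall_mem {p q : X → ℝ} {C : Finset X} {xs : Fin N → X}
    (h : ∀ i, xs i ∈ C) :
    weightVec (restrictLaw p C) q xs = (∑ y ∈ C, p y)⁻¹ • weightVec p q xs := by
  funext i
  simp only [weightVec, restrictLaw, h i, if_true, Pi.smul_apply, smul_eq_mul]
  ring

omit [DecidableEq X] in
/-- Total mass of the i.i.d. law. [folklore] -/
theorem sum_iidLaw (q : X → ℝ) : ∑ xs : Fin N → X, iidLaw q xs = (∑ x, q x) ^ N := by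
  unfold iidLaw
  rw [← Fintype.prod_sum (fun (_ : Fin N) (x : X) => q x), Finset.prod_const, Finset.card_univ,
    Fintype.card_fin]

omit [Fintype X] [DecidableEq X] in
/-- Mass of the i.i.d. law on the samples that all fall in `C`: `q(C)^N`. [folklore] -/
theorem sum_iidLaw_piFinset (q : X → ℝ) (C : Finset X) :
    ∑ xs ∈ Fintype.piFinset (fun _ : Fin N => C), iidLaw q xs = (∑ x ∈ C, q x) ^ N := by
  unfold iidLaw
  rw [Finset.sum_prod_piFinset C (fun (_ : Fin N) (x : X) => q x), Finset.prod_const,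
    Finset.card_univ, Fintype.card_fin]

/-- **T2-L (blindness of model-sample diagnostics; provable, proved).**  Let `S` be any
SCALE-INVARIANT statistic of the importance-weight vector of `N` model samples (normalised ESS
`(Σw)²/(N Σw²)`, the independence-Metropolis accept/reject decisions `min(1, w'/w)`, the
self-normalised reverse-KL estimate up to its additive constant, …).  Then `S` computed for the
true target `p` and for the target `p|_C` with every mode outside `C` DELETED agree on every
sample inside `C^N`; hence they differ on a set of model-probability at most `1 − q(C)^N`
(`≤ N·(1 − q(C))`).  If the model puts mass `q(Cᶜ) ≪ 1/N` on the uncovered sectors, no diagnostic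
built from `N` model samples can tell that they are missing — while the reweighting bias of a
`Cᶜ`-sensitive observable is `O(p(Cᶜ))` (T2-L′ below).  Finite shadow of the mode-collapse
analyses of Hackett et al. 2021 (arXiv:2107.00734) and Nicoli et al. 2023 (arXiv:2302.14082).
[folklore] -/
theorem blindness {α : Type*} [DecidableEq α] (S : (Fin N → ℝ) → α)
    (hS : ∀ c : ℝ, 0 < c → ∀ w : Fin N → ℝ, S (c • w) = S w)
    {p q : X → ℝ} (hq : ∀ x, 0 ≤ q x) (hq1 : ∑ x, q x = 1) {C : Finset X}
    (hC : 0 < ∑ y ∈ C, p y) :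
    ∑ xs ∈ univ.filter (fun xs => S (weightVec p q xs) ≠ S (weightVec (restrictLaw p C) q xs)),
        iidLaw q xs ≤ 1 - (∑ x ∈ C, q x) ^ N := by
  classical
  set G : Finset (Fin N → X) := Fintype.piFinset (fun _ : Fin N => C) with hG
  have hsub : univ.filter (fun xs => S (weightVec p q xs) ≠ S (weightVec (restrictLaw p C) q xs))
      ⊆ univ \ G := by
    intro xs hxs
    rw [Finset.mem_sdiff]
    refine ⟨Finset.mem_univ _, fun hG' => ?_⟩
    have hall : ∀ i, xs i ∈ C := fun i => Fintype.mem_piFinset.1 hG' i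
    have := (Finset.mem_filter.1 hxs).2
    apply this
    rw [weightVec_restrictLaw_of_forall_mem hall, hS _ (inv_pos.2 hC)]
  have hnn : ∀ xs ∈ univ \ G, 0 ≤ iidLaw q xs := fun xs _ => Finset.prod_nonneg fun i _ => hq _
  calc ∑ xs ∈ univ.filter
          (fun xs => S (weightVec p q xs) ≠ S (weightVec (restrictLaw p C) q xs)), iidLaw q xs
      ≤ ∑ xs ∈ univ \ G, iidLaw q xs := Finset.sum_le_sum_of_subset_of_nonneg hsub
          (fun xs hxs _ => hnn xs hxs)
    _ = ∑ xs, iidLaw q xs - ∑ xs ∈ G, iidLaw q xs := by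
          rw [Finset.sum_sdiff_eq_sub (Finset.subset_univ _)]
    _ = 1 - (∑ x ∈ C, q x) ^ N := by rw [sum_iidLaw, hq1, one_pow, hG, sum_iidLaw_piFinset]

/-- Total variation between the target and its restriction to the covered set is exactly the
uncovered mass `p(Cᶜ) = 1 − p(C)`. -/
theorem tvDist_restrictLaw {p : X → ℝ} (hp : ∀ x, 0 ≤ p x) (hp1 : ∑ x, p x = 1) {C : Finset X}
    (hC : 0 < ∑ y ∈ C, p y) : tvDist p (restrictLaw p C) = 1 - ∑ y ∈ C, p y := by
  classical
  set c := ∑ y ∈ C, p y with hc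
  have hc1 : c ≤ 1 := by
    rw [hc, ← hp1]; exact Finset.sum_le_sum_of_subset_of_nonneg (Finset.subset_univ _)
      (fun x _ _ => hp x)
  unfold tvDist
  -- split the sum over `C` and its complement
  rw [← Finset.sum_add_sum_compl C]
  have hin : ∀ x ∈ C, |p x - restrictLaw p C x| = p x / c - p x := by
    intro x hx
    simp only [restrictLaw, hx, if_true]
    rw [abs_sub_comm, abs_of_nonneg]
    rw [sub_nonneg, le_div_iff₀ hC]
    exact mul_le_of_le_one_right (hp x) hc1
  have hout : ∀ x ∈ Cᶜ, |p x - restrictLaw p C x| = p x := by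
    intro x hx
    simp only [restrictLaw, Finset.mem_compl.1 hx, if_false, sub_zero, abs_of_nonneg (hp x)]
  rw [Finset.sum_congr rfl hin, Finset.sum_congr rfl hout, Finset.sum_sub_distrib,
    ← Finset.sum_div, div_self hC.ne']
  have hcompl : ∑ x ∈ Cᶜ, p x = 1 - c := by
    rw [hc, ← hp1, ← Finset.sum_add_sum_compl C]; ring
  rw [hcompl]; ring

/-- **T2-L′ (the price of blindness).**  The reweighting estimator built on the mode-collapsed
target `p|_C` is biased for `p` by up to `2·sup|O|·p(Cᶜ)`: for a bounded observable,
`|E_p O − E_{p|C} O| ≤ 2 M (1 − p(C))`. [folklore] -/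
theorem bias_restrictLaw {p : X → ℝ} (hp : ∀ x, 0 ≤ p x) (hp1 : ∑ x, p x = 1) {C : Finset X}
    (hC : 0 < ∑ y ∈ C, p y) {O : X → ℝ} {M : ℝ} (hO : ∀ x, |O x| ≤ M) :
    |∑ x, p x * O x - ∑ x, restrictLaw p C x * O x| ≤ 2 * M * (1 - ∑ y ∈ C, p y) := by
  rw [← tvDist_restrictLaw hp hp1 hC, tvDist, ← Finset.sum_sub_distrib]
  calc |∑ x, (p x * O x - restrictLaw p C x * O x)|
      ≤ ∑ x, |p x * O x - restrictLaw p C x * O x| := Finset.abs_sum_le_sum_abs _ _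
    _ = ∑ x, |p x - restrictLaw p C x| * |O x| := by
          refine Finset.sum_congr rfl fun x _ => ?_
          rw [← sub_mul, abs_mul]
    _ ≤ ∑ x, |p x - restrictLaw p C x| * M :=
          Finset.sum_le_sum fun x _ => mul_le_mul_of_nonneg_left (hO x) (abs_nonneg _)
    _ = 2 * M * (1 / 2 * ∑ x, |p x - restrictLaw p C x|) := by rw [← Finset.sum_mul]; ring

end Blindness

end Summit.Ventures.LatticeQCDFlow.Theory2
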